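import Literature.NumberTheory.Automorphic.CDTTheorem722ThreeFactsProofs
import Literature.NumberTheory.EllipticCurves.EisensteinNewformLevelRaising
import Literature.NumberTheory.EllipticCurves.NewformGaloisRepEulerFactors
import Literature.NumberTheory.EllipticCurves.NewformGaloisRepArtinConductor
import Literature.NumberTheory.EllipticCurves.NewformGaloisRepDetProofs
import Literature.NumberTheory.EllipticCurves.NewformGaloisRepRibetThm23Proofs
import Literature.NumberTheory.EllipticCurves.NewformGaloisRepPadicAlgClProofs
import Literature.NumberTheory.GaloisRepresentations.FramedRepBaseChange
import HarnessLib

/-!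
# Stub ideation `stub_threeImpTwo` — ideator k = 1, generation 8 (FAMILY 1: recognise & import)

Companion of `STUB-IDEAS-stub_threeImpTwo-1.md` (gen 8).  The ONE new item of this generation:
the realisation input `R(p)` of the gen-5–7 architecture is IMPORTED BY NAME from the catalogued
one-completion Deligne fact `exists_padicGaloisRep_of_isNewform1` (`NewformGaloisRep.lean`), whose
discharge in the tree rests on `Ribet1977.thm21_exists_galoisRep` ALONE
(`exists_padicGaloisRep_of_isNewform1_of_thm21_of_thm23` + `Ribet1977.thm23_isIrreducible_holds`).
Gen 5 typed this arrow as `L4` with `sorry`; gens 6–7 replaced it by the stronger Jacobian leaves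
`J(3)`, `J(5)` (`DeligneHeckeRep`).  Here `L4` is split into four one-cycle helpers D1–D4.

Everything else enters BY NAME (types `TwoRealisationSeam`, `PacketLeavesCloser`): those arrows are
kernel-checked in `STUB_IDEAS_stub_threeImpTwo_1g7.lean` (:318) and
`STUB_IDEAS_stub_threeImpTwo_2g6_Sketch.lean` (:1456 ∘ :1114), which are not importable modules.
-/

noncomputable section

open scoped NumberField Polynomial MatrixGroups ModularForm
open NumberField IsDedekindDomain IsDedekindDomain.HeightOneSpectrum Field Polynomial
open CongruenceSubgroup Rat.HeightOneSpectrum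
open Literature.NumberTheory.EllipticCurves
open Literature.NumberTheory.EllipticCurves.ModularForms
open Literature.NumberTheory.EllipticCurves.ModularForms.DeligneSerre1974
open Literature.NumberTheory.Automorphic
open Literature.NumberTheory.Automorphic.BCDT
open Literature.NumberTheory.GaloisRepresentations
open WeierstrassCurve

namespace Summit.ABC.ABC.Cruxes.FreyModularity.Sketch.StubIdeasThreeImpTwo1G8

/-! ## §0 Currencies (verbatim from k1 g5–g7 / k2 g6) -/

/-- The registered stub's type, character for character (`Lines/Sketch.lean`, `stub_threeImpTwo`). -/
def SigS9 : Prop :=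
  ∀ (W : WeierstrassCurve ℚ) [W.IsElliptic] [NeZero (W.conductorNorm ℤ)] (ℓ : ℕ) [Fact ℓ.Prime],
    W.IsModularGaloisRepTate ℓ → BCDT.IsModular W

example : SigS9 = (∀ (W : WeierstrassCurve ℚ) [W.IsElliptic] [NeZero (W.conductorNorm ℤ)] (ℓ : ℕ)
    [Fact ℓ.Prime], W.IsModularGaloisRepTate ℓ → BCDT.IsModular W) := rfl

/-- **`R(p)`** (verbatim k1 gens 5–7): realisation of RATIONAL weight-two `Γ₀`-newforms at the
FIXED prime `p`, in Carayol's currency. -/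
def RealisationAt (p : ℕ) [Fact p.Prime] : Prop :=
  ∀ {N : ℕ} [NeZero N] (f₀ : CuspForm (Gamma0 N) 2), IsNewform0 f₀ →
    (∀ n : ℕ, ∃ z : ℤ, cuspCoeff f₀ n = z) → ∀ ι : PadicAlgCl p ≃+* ℂ,
      ∃ ρ : FramedGaloisRep ℚ (PadicAlgCl p) 2,
        IsGaloisRepOfNewform1 (liftToGamma1 N 2 f₀)
          ((ι.symm : ℂ →+* PadicAlgCl p).comp (algebraMap (coeffCharField (liftToGamma1 N 2 f₀)) ℂ))
          {q | q ∣ N * p} ρ ∧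
        ρ.toGaloisRep.IsIrreducible

/-- **`SomeLevelPacket`** (verbatim k2 g6 / k1 g7). -/
def SomeLevelPacket : Prop :=
  ∀ (W : WeierstrassCurve ℚ) [W.IsElliptic] (ℓ : ℕ) [Fact ℓ.Prime], W.IsModularGaloisRepTate ℓ →
    ∃ (N : ℕ) (_ : NeZero N) (f₀ : CuspForm (Gamma0 N) 2), IsNewform0 f₀ ∧
      (∀ v : HeightOneSpectrum (𝓞 ℚ), ¬ ((primesEquiv v : ℕ) ∣ N) → W.HasGoodReductionAt v) ∧
      ∀ p : ℕ, p.Prime → ¬ p ∣ N → cuspCoeff f₀ p = (W.LFunction p : ℂ)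

/-- **`Newform0SteinbergCoinvariants`** (verbatim k2 g6 :546 / k1 g7 :104): the Steinberg corner of
Carayol's local–global compatibility (Darmon–Diamond–Taylor Thm. 3.1 (e), first case).
[cite: DarmonDiamondTaylor1995, Thm. 3.1 (e) (p. 86)] [cite: CarayolASENS1986, Thm. (A)] -/
def Newform0SteinbergCoinvariants : Prop :=
  ∀ {N : ℕ} [NeZero N] (f₀ : CuspForm (Gamma0 N) 2), IsNewform0 f₀ →
    ∀ (p : ℕ) [Fact p.Prime] (ι : PadicAlgCl p ≃+* ℂ) (ρ : FramedGaloisRep ℚ (PadicAlgCl p) 2),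
      IsGaloisRepOfNewform1 (liftToGamma1 N 2 f₀)
        ((ι.symm : ℂ →+* PadicAlgCl p).comp (algebraMap (coeffCharField (liftToGamma1 N 2 f₀)) ℂ))
          {q | q ∣ N * p} ρ →
      ρ.toGaloisRep.IsIrreducible →
    ∀ ℓ : ℕ, ℓ.Prime → ℓ ≠ p → ℓ ∣ N → ¬ ℓ ^ 2 ∣ N →
    ∀ w : HeightOneSpectrum (𝓞 ℚ), (ℓ : 𝓞 ℚ) ∈ w.asIdeal → ∀ 𝔔 ∈ w.primesAbove,
    ∀ σ : 𝔔.decompositionSubgroup (absoluteGaloisGroup ℚ),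
      IsArithFrobAt (𝓞 ℚ) (σ : absoluteGaloisGroup ℚ) 𝔔 →
      (ρ.toGaloisRep.toInertiaCoinvariants 𝔔 σ).charpoly.reverse =
        1 - C (ι.symm (cuspCoeff (liftToGamma1 N 2 f₀) ℓ)) * X +
          C (ι.symm ((nebentypus (liftToGamma1 N 2 f₀) (ℓ : ZMod N) : ℂ) *
            (ℓ : ℂ) ^ ((2 : ℤ) - 1))) * X ^ 2

/-! ## §1 NEW (gen 8): the Deligne leaf BY NAME and `L4` split into one-cycle helpers -/

/-- **D — the Deligne leaf, BY NAME**: the weight-two slice of the catalogued named fact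
`exists_padicGaloisRep_of_isNewform1` (Ribet 1977 Thm. (2.1) + (2.3); one completion of `K_f`,
absolutely irreducible).  Its `_holds` is architected in the tree as
`exists_padicGaloisRep_of_isNewform1_of_thm21_of_thm23 h21 Ribet1977.thm23_isIrreducible_holds`. -/
def DeligneLeaf : Prop :=
  ∀ {N : ℕ} [NeZero N] (f : CuspForm (Gamma1 N) 2), exists_padicGaloisRep_of_isNewform1 (f := f)

/-- **D0 (XS, PROVED — tree only).** The Deligne leaf from Ribet 1977 Thm. (2.1) in weight `2`
alone (Thm. (2.3) is `Ribet1977.thm23_isIrreducible_holds`, landed 2026-08-15). -/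
theorem deligneLeaf_of_thm21
    (h21 : ∀ {N : ℕ} [NeZero N], Ribet1977.thm21_exists_galoisRep (N := N) (k := 2)) :
    DeligneLeaf :=
  fun f ↦ exists_padicGaloisRep_of_isNewform1_of_thm21_of_thm23 h21
    Ribet1977.thm23_isIrreducible_holds (f := f)

/-- **D1 (XS).** The coefficient-and-character field of the `Γ₁`-lift of a RATIONAL `Γ₀`-newform is
`ℚ` (the tree's `coeffCharField_liftToGamma1_eq_bot`, which assumes `IsNewformOf W f`, with the
curve replaced by the bare integrality hypothesis of `RealisationAt`). [folklore] -/
theorem coeffCharField_liftToGamma1_eq_bot_of_int {N : ℕ} [NeZero N] {f₀ : CuspForm (Gamma0 N) 2}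
    (hf₀ : IsNewform0 f₀) (hint : ∀ n : ℕ, ∃ z : ℤ, cuspCoeff f₀ n = z) :
    coeffCharField (liftToGamma1 N 2 f₀) = ⊥ := by
  have h0 : f₀ ≠ 0 := by
    intro h
    have h1 : cuspCoeff f₀ 1 = 1 := (isNormalized_iff_cuspCoeff_one f₀).mp hf₀.2.2
    rw [h] at h1
    simp [cuspCoeff, UpperHalfPlane.qExpansion_zero] at h1
  have hcoe : (⇑(liftToGamma1 N 2 f₀) : UpperHalfPlane → ℂ) = ⇑f₀ := coe_liftToGamma1_holds N 2 f₀
  have hε : nebentypus (liftToGamma1 N 2 f₀) = 1 := nebentypus_liftToGamma1_holds N 2 h0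
  rw [coeffCharField, IntermediateField.adjoin_eq_bot_iff]
  rintro x (⟨n, rfl⟩ | ⟨n, rfl⟩)
  · dsimp only
    rw [SetLike.mem_coe, IntermediateField.mem_bot]
    obtain ⟨z, hz⟩ := hint n
    refine ⟨(z : ℚ), ?_⟩
    rw [map_intCast, hcoe]
    exact hz.symm
  · dsimp only
    rw [SetLike.mem_coe, hε]
    by_cases hu : IsUnit ((n : ℕ) : ZMod N)
    · rw [MulChar.one_apply hu]
      exact one_mem _
    · rw [MulChar.map_nonunit _ hu]
      exact zero_mem _

/-- **D2 (XS).** Ring homomorphisms out of a coefficient field equal to `ℚ` are unique (every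
element is rational; ring maps `ℚ → R` are unique, Mathlib `Rat.subsingleton_ringHom`). [folklore] -/
theorem ringHom_eq_of_coeffCharField_eq_bot {N : ℕ} [NeZero N] {k : ℤ} {g : CuspForm (Gamma1 N) k}
    (hK : coeffCharField g = ⊥) {R : Type*} [Semiring R] (φ ψ : coeffCharField g →+* R) :
    φ = ψ := by
  refine RingHom.ext fun x ↦ ?_
  have hx : (x : ℂ) ∈ (⊥ : IntermediateField ℚ ℂ) := hK ▸ x.2
  rw [IntermediateField.mem_bot] at hx
  obtain ⟨q, hq⟩ := hx
  have hxq : x = algebraMap ℚ (coeffCharField g) q := Subtype.ext (by simpa using hq.symm)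
  rw [hxq, ← RingHom.comp_apply, ← RingHom.comp_apply,
    Subsingleton.elim (φ.comp (algebraMap ℚ (coeffCharField g))) (ψ.comp (algebraMap ℚ _))]

/-- **D3 (S).** A finite extension `E / ℚ_p` with its module topology embeds CONTINUOUSLY into
`ℚ̄_p` (`IsAlgClosed.lift`; automatic continuity of `ℚ_p`-linear maps out of a module-topology
space, Mathlib `IsModuleTopology.continuous_of_linearMap`). [folklore] -/
theorem exists_continuous_ringHom_padicAlgCl {p : ℕ} [Fact p.Prime] (E : Type) [Field E]
    [Algebra ℚ_[p] E] [FiniteDimensional ℚ_[p] E] [TopologicalSpace E] [IsModuleTopology ℚ_[p] E] :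
    ∃ φ : E →+* PadicAlgCl p, Continuous φ := by
  let φa : E →ₐ[ℚ_[p]] PadicAlgCl p := IsAlgClosed.lift
  exact ⟨φa.toRingHom, IsModuleTopology.continuous_of_linearMap φa.toLinearMap⟩

/-- **D4 = gen-5 `L4` (S/M): `D → R(p)` at EVERY prime `p`.**  For a rational newform `f₀`, the
one-completion Deligne representation `ρ` over `E ⊇ ℚ_p` (with `ι₀ : K_g → E`, `K_g = ℚ` by D1),
base-changed along a continuous `φ : E → ℚ̄_p` (D3), is attached to `g = liftToGamma1 N 2 f₀`
through `ι⁻¹ ∘ (K_g ⊆ ℂ)` — the two coefficient maps `φ ∘ ι₀`, `ι⁻¹ ∘ (K_g ⊆ ℂ) : K_g → ℚ̄_p`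
coincide by D2 — (`FramedGaloisRep.isUnramifiedAt_baseChange_iff`, `hasFrobCharpolyAt_baseChange`)
and is irreducible over `ℚ̄_p` (absolute irreducibility at `φ`), exactly as in the tree's
`Hida2000_thm326_exists_galoisRep_of_thm61` but with NO place-cutting (one place above `p`). -/
theorem realisationAt_of_deligneLeaf (hD : DeligneLeaf) (p : ℕ) [Fact p.Prime] :
    RealisationAt p := by
  intro N _ f₀ hf₀ hint ι
  have hg : IsNewform1 (liftToGamma1 N 2 f₀) :=
    (isNewform1_liftToGamma1_iff_holds (N := N) (k := 2) f₀).mpr hf₀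
  obtain ⟨E, _, _, _, _, _, ι₀, ρ, hρ, habs⟩ := hD (liftToGamma1 N 2 f₀) le_rfl hg p
  obtain ⟨φ, hφc⟩ := exists_continuous_ringHom_padicAlgCl (p := p) E
  have hK : coeffCharField (liftToGamma1 N 2 f₀) = ⊥ :=
    coeffCharField_liftToGamma1_eq_bot_of_int hf₀ hint
  have hcomp : φ.comp ι₀ =
      (ι.symm : ℂ →+* PadicAlgCl p).comp (algebraMap (coeffCharField (liftToGamma1 N 2 f₀)) ℂ) :=
    ringHom_eq_of_coeffCharField_eq_bot hK _ _
  refine ⟨FramedRep.baseChange φ hφc ρ, ?_, ?_⟩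
  · intro w hw
    obtain ⟨hur, hchar⟩ := hρ w hw
    refine ⟨(FramedGaloisRep.isUnramifiedAt_baseChange_iff φ hφc φ.injective w ρ).mpr hur, ?_⟩
    have h := FramedGaloisRep.hasFrobCharpolyAt_baseChange φ hφc hchar
    rwa [Polynomial.map_map, hcomp] at h
  · exact habs (PadicAlgCl p) φ

/-! ## §2 Assembly BY NAME (the arrows kernel-checked in k1 g7 / k2 g6) -/

/-- **The k1 g7 seam, BY NAME** (`someLevelPacket_of_two_realisations`, g7 :318, PROVED there
from H7 = `hasGoodReductionAt_and_cuspCoeff_eq_of_realisation`): realisations at two distinct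
primes fill the `ℓ`-hole. -/
def TwoRealisationSeam : Prop :=
  ∀ (p₁ p₂ : ℕ) [Fact p₁.Prime] [Fact p₂.Prime], p₁ ≠ p₂ →
    RealisationAt p₁ → RealisationAt p₂ → SomeLevelPacket

/-- **The k2 g6 packet closer, BY NAME** (verbatim k1 g7 :372). -/
def PacketLeavesCloser : Prop :=
  SomeLevelPacket → Carayol1986_artinConductorExponent →
    (∀ (V : WeierstrassCurve ℚ) (ℓ : ℕ) [Fact ℓ.Prime],
      V.swanConductorAt_rationalTate_eq_wildConductorExponent_of_ringChar_eq_two ℓ) →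
    Newform0SteinbergCoinvariants → SigS9

/-- **D5 (XS, PROVED): `D → SomeLevelPacket`** through the seam at the primes `2 ≠ 3` (Mathlib
`Fact` instances `fact_prime_two/three`; no tree instance for `5` needed). -/
theorem someLevelPacket_of_deligneLeaf (hSeam : TwoRealisationSeam) (hD : DeligneLeaf) :
    SomeLevelPacket :=
  hSeam 2 3 (by decide) (realisationAt_of_deligneLeaf hD 2) (realisationAt_of_deligneLeaf hD 3)

/-- **Gen-8 closer (PROVED modulo the two named glue arrows): the VERBATIM stub from the leaf set
{`exists_padicGaloisRep_of_isNewform1` (k = 2), Carayol (A), Saito-at-2 ∀ curves, Steinberg corner}.** -/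
theorem sigS9_of_deligne_leaves (hSeam : TwoRealisationSeam) (hK2 : PacketLeavesCloser)
    (hD : DeligneLeaf) (hCA : Carayol1986_artinConductorExponent)
    (hS : ∀ (V : WeierstrassCurve ℚ) (ℓ : ℕ) [Fact ℓ.Prime],
      V.swanConductorAt_rationalTate_eq_wildConductorExponent_of_ringChar_eq_two ℓ)
    (hSt : Newform0SteinbergCoinvariants) : SigS9 :=
  hK2 (someLevelPacket_of_deligneLeaf hSeam hD) hCA hS hSt

/-- The verbatim stub, as the skeleton states it, one named fact deeper: from Ribet 1977 Thm. (2.1)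
in weight `2` (Deligne's construction — the tree's single residual under `DeligneLeaf`). -/
theorem stub_threeImpTwo_of_thm21 (hSeam : TwoRealisationSeam) (hK2 : PacketLeavesCloser)
    (h21 : ∀ {N : ℕ} [NeZero N], Ribet1977.thm21_exists_galoisRep (N := N) (k := 2))
    (hCA : Carayol1986_artinConductorExponent)
    (hS : ∀ (V : WeierstrassCurve ℚ) (ℓ : ℕ) [Fact ℓ.Prime],
      V.swanConductorAt_rationalTate_eq_wildConductorExponent_of_ringChar_eq_two ℓ)
    (hSt : Newform0SteinbergCoinvariants) :
    ∀ (W : WeierstrassCurve ℚ) [W.IsElliptic] [NeZero (W.conductorNorm ℤ)] (ℓ : ℕ) [Fact ℓ.Prime],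
      W.IsModularGaloisRepTate ℓ → BCDT.IsModular W :=
  sigS9_of_deligne_leaves hSeam hK2 (deligneLeaf_of_thm21 h21) hCA hS hSt

end Summit.ABC.ABC.Cruxes.FreyModularity.Sketch.StubIdeasThreeImpTwo1G8

end
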